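import Literature.Topology.FourManifolds.FlipEdge
import HarnessLib

/-!
# The unit lemma: the bent knot of the spiked flip frame is the second summand

Topic `Literature/Topology/FourManifolds` (trunk T-4MAN). Fact seat
`provefact-Literature.Topology.FourManifolds.Knot.IsConnectedSum.isIsotopic` (Schubert's theorem),
geometric heart for rail knots. For a flip pair `(b₁, b₂)` with `B₁ = R ∘ A₂`, at a uniform shrink
scale of `b₁`, an arc scale of `b₂` and the pair scale, the **bent knot** of the spiked flip frame
at `u = 1` (`ExitBend.lean`: the content of `b₁` shrunk along the straight chord segment of the
bend skeleton and bent out — "the skeleton of `b₁` with its unit, closed up by the reflected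
necks and chord of `b₂`") is isotopic to `B₁`:

  `bentKnot ≃ frameKnot (flipSpikedC 1) = flipKnot 1 ≃ flipKnot 0 = spikedFrameKnot (flipBase 0)
   ≃ frameKnot (flipBase 0) = frameKnotZero ≃ B₁`

(`ExitBend.isIsotopic_frameKnot_bentKnot`, `FlipWall.isIsotopic_flipKnot`,
`WallSpikes.isIsotopic_frameKnot_spikedFrameKnot`, `FlipEdge.isIsotopic_frameKnotZero_B`).

Everything is proved; no named facts are introduced.

## References

* M. W. Hirsch, *Differential Topology*, Springer GTM 33 (1976), Ch. 8 §1. [HirschDT1976]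
-/

open scoped Manifold ContDiff Topology Real
open Function Set Metric Filter

noncomputable section

namespace Literature.Topology.FourManifolds

/-- Local notation: `𝔼 n` is the model Euclidean space `EuclideanSpace ℝ (Fin n)`. -/
local notation "𝔼 " n:arg => EuclideanSpace ℝ (Fin n)

/-- Local notation: `𝕊 n` is the unit sphere in `EuclideanSpace ℝ (Fin (n + 1))`. -/
local notation "𝕊 " n:arg => (Metric.sphere (0 : EuclideanSpace ℝ (Fin (n + 1))) 1)

attribute [local instance] fact_finrank_euclideanSpace_succ

open KnotsInBall

namespace BandData

variable {A₁ B₁ K₁ : Knot} {b₁ : BandData A₁ B₁ K₁ ∅} {A₂ B₂ K₂ : Knot} {b₂ : BandData A₂ B₂ K₂ ∅}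
  {hcross₁ : b₁.band ⁻¹' sphereEquator 2 ∩ squareNhd b₁.δ = {x ∈ squareNhd b₁.δ | x 0 = 2⁻¹}}
  {hcross₂ : b₂.band ⁻¹' sphereEquator 2 ∩ squareNhd b₂.δ = {x ∈ squareNhd b₂.δ | x 0 = 2⁻¹}}
  {ε r A' κ ε₂ r₂ : ℝ} (HU : b₁.ShrinkScaleU hcross₁ ε r A' κ) (h₂ : b₂.ArcScale hcross₂ ε₂ r₂ κ)
  (hP : IsFlipPair b₁ b₂) (hBA : B₁ = A₂.map (reflectLastDiffeo 3)) (hT : PairScale hP hcross₂ hcross₁ κ)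
  {ε₁' r₁' : ℝ} (hf₁ : b₁.IsFlat hcross₁ ε₁' r₁') (hε₁ : ε₁' ≤ 1 / 100) (hr₁ : 5 * κ < r₁')
  (hA₁ : A₁.InNorth) (hB₁ : B₁.InSouth) (hAB₁ : Disjoint (range A₁) (range B₁)) (hB₂ : B₂.InSouth)

/-- **The flip knot at `u = 0` is the spiked frame knot of the un-spiked flip frame.** [folklore] -/
theorem flipKnot_zero_eq_spikedFrameKnot :
    flipKnot h₂ hT HU.cone hf₁ hε₁ hr₁ hA₁ hB₁ hAB₁ hB₂ (u := 0) ⟨le_rfl, zero_le_one⟩ =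
      b₁.spikedFrameKnot HU.cone.spike (isNeckFrame_flipBase HU.cone.spike h₂ hT hA₁ hB₁ hAB₁ hB₂ (u := 0) ⟨le_rfl, zero_le_one⟩)
        hf₁ hε₁ hr₁ :=
  IsRegularLoop.toKnot_congr (isWallFrame_flipSpikedC h₂ hT HU.cone hf₁ hε₁ hr₁ hA₁ hB₁ hAB₁ hB₂ (u := 0) ⟨le_rfl, zero_le_one⟩).isRegularLoop
    _ (periodise_simple_iff.2 (isWallFrame_flipSpikedC h₂ hT HU.cone hf₁ hε₁ hr₁ hA₁ hB₁ hAB₁ hB₂ (u := 0) ⟨le_rfl, zero_le_one⟩).injOn) _ rfl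

/-- **The un-spiked flip frame knot is the frame knot `frameKnotZero` of `FlipClean.lean`.** [folklore] -/
theorem frameKnot_flipBase_zero_eq :
    (isNeckFrame_flipBase HU.cone.spike h₂ hT hA₁ hB₁ hAB₁ hB₂ (u := 0) ⟨le_rfl, zero_le_one⟩).frameKnot =
      frameKnotZero HU.cone.spike h₂ hT hA₁ hB₁ hAB₁ hB₂ := rfl

include hBA in
/-- **The un-spiked flip knot is isotopic to the second summand.** [cite: HirschDT1976, Ch. 8 §1, Thm. 1.3] -/
theorem isIsotopic_flipKnot_zero_B :
    (flipKnot h₂ hT HU.cone hf₁ hε₁ hr₁ hA₁ hB₁ hAB₁ hB₂ (u := 0) ⟨le_rfl, zero_le_one⟩).IsIsotopic B₁ := by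
  rw [flipKnot_zero_eq_spikedFrameKnot HU h₂ hP hT hf₁ hε₁ hr₁ hA₁ hB₁ hAB₁ hB₂]
  have hs := b₁.isIsotopic_frameKnot_spikedFrameKnot HU.cone.spike
    (isNeckFrame_flipBase HU.cone.spike h₂ hT hA₁ hB₁ hAB₁ hB₂ (u := 0) ⟨le_rfl, zero_le_one⟩) hf₁ hε₁ hr₁
  exact IsAmbientIsotopic.trans_holds (IsAmbientIsotopic.symm_holds hs)
    (isIsotopic_frameKnotZero_B HU.cone.spike h₂ hP hBA hT hA₁ hB₁ hAB₁ hB₂)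

include hBA in
/-- **THE FLIP KNOT AT `u = 1` (reflected necks and straight chord of `b₂`) IS ISOTOPIC TO THE SECOND
SUMMAND.** [cite: HirschDT1976, Ch. 8 §1, Thm. 1.3] -/
theorem isIsotopic_flipKnot_one_B :
    (flipKnot h₂ hT HU.cone hf₁ hε₁ hr₁ hA₁ hB₁ hAB₁ hB₂ (u := 1) ⟨zero_le_one, le_rfl⟩).IsIsotopic B₁ :=
  IsAmbientIsotopic.trans_holds (IsAmbientIsotopic.symm_holds (isIsotopic_flipKnot h₂ hT HU.cone hf₁ hε₁ hr₁ hA₁ hB₁ hAB₁ hB₂))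
    (isIsotopic_flipKnot_zero_B HU h₂ hP hBA hT hf₁ hε₁ hr₁ hA₁ hB₁ hAB₁ hB₂)

include hBA in
/-- **THE UNIT LEMMA.** The bent knot of the spiked flip frame at `u = 1` — the bend skeleton of `b₁`
carrying the unit of `b₁`, closed up by the reflected necks and chord of `b₂` — is isotopic to `B₁`.
[cite: HirschDT1976, Ch. 8 §1, Thm. 1.3] -/
theorem isIsotopic_bentKnot_flip_B {lam₀ rA : ℝ} (hl : lam₀ ∈ Ioc (0 : ℝ) 1) (hrA : 0 < rA) :
    (b₁.bentKnot HU (isWallFrame_flipSpikedC h₂ hT HU.cone hf₁ hε₁ hr₁ hA₁ hB₁ hAB₁ hB₂ (u := 1) ⟨zero_le_one, le_rfl⟩)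
      hl hrA hB₁ hAB₁).IsIsotopic B₁ := by
  have hb := b₁.isIsotopic_frameKnot_bentKnot HU
    (isWallFrame_flipSpikedC h₂ hT HU.cone hf₁ hε₁ hr₁ hA₁ hB₁ hAB₁ hB₂ (u := 1) ⟨zero_le_one, le_rfl⟩) hl hrA hB₁ hAB₁
  exact IsAmbientIsotopic.trans_holds (IsAmbientIsotopic.symm_holds hb)
    (isIsotopic_flipKnot_one_B HU h₂ hP hBA hT hf₁ hε₁ hr₁ hA₁ hB₁ hAB₁ hB₂)

end BandData

end Literature.Topology.FourManifolds
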